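/-
Copyright: the b2b-balaban T⁴-continuum CRUX team, row NE7b OWNER lineage `t4-ne7b-p1` (gen 105). Project licence.
-/
import Summits.QuantumFields.BalabanUV.T4Continuum.Spine.NE7b.GaussianDominatedMoment

/-!
# The Gaussian domination lemma IN CLOSED FORM: the determinant formula `∫ e^{−xᵀSx} dx = π^{n/2} ∕ √(det S)`, the moment as
# `√(det S ∕ det(S − Q))`, the DETERMINANT READING `(1 − δ)^r · det S ≤ det(S − Q)` of the lemma, and its SHARPNESS
# (row NE7b, node U5c; kernel theorems of real analysis ∕ linear algebra)

Cell `pub-balaban`, sub-cell `t4`, spine estimate NE7b (`T4WeightBudget.RelWeightBound`; the cell's OWN estimate — NOT PRINTED in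
[Bałaban 1983–89], NOT PROVED).  Crux-route work under `Spine/NE7b/` by the row's OWNER; NOTHING of Bałaban's is named or asserted;
no `T4Continuum/Support` leaf typed; zero `sorry`.

WHY.  Two loose ends of `…NE7b.GaussianDominatedMoment` that a reader (and the refuter desk) will ask for.  (1) The moment carrier of
a Gaussian one-step kernel depends on the BACKGROUND through the forms `S_y, Q_y`; the junction `locCondStability_of_carrier_le` wants
it a.e.-strongly measurable in `y`.  In CLOSED FORM the carrier is `√(det S_y ∕ det(S_y − Q_y))` — an algebraic function of the
displayed data, so its measurability ∕ continuity in the background is that of the data.  (2) Is the price `(√(1−δ))⁻¹ ^ r` an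
artefact of the proof?  No: it is ATTAINED when all `n` directions are saturated (`Q = δ·S`), and in determinant currency the lemma
IS the inequality `(1 − δ)^{rank Q} · det S ≤ det(S − Q)` for `0 ≤ Q ≤ δ S`.

WHAT IS PROVED ([folklore]):
* §1 `abs_det_eq_of_congr_one` (`Aᵀ S A = 1 ⟹ |det A| = (√(det S))⁻¹`), **`integral_exp_neg_qf_eq`** (THE GAUSSIAN DETERMINANT
  FORMULA `∫ e^{−xᵀSx} dx = (Π_i √π) · (√(det S))⁻¹` for positive-definite `S`); `sqrt_pow_eq` (§4 helper).
* §2 `posDef_sub_of_dominated` (`Q ≤ δS`, `δ < 1` ⟹ `S − Q` positive definite), **`integral_exp_qf_mul_exp_neg_eq`**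
  (`∫ e^{xᵀQx} e^{−xᵀSx} dx = (Π_i √π) · (√(det(S − Q)))⁻¹`), **`gaussianMoment_eq`** (the normalised moment IS
  `√(det S) ∕ √(det(S − Q))` — closed form in the displayed data).
* §3 **`det_le_det_sub_of_dominated`** (THE DETERMINANT READING of the domination lemma: `(1 − δ)^r · det S ≤ det(S − Q)` whenever
  `0 ≤ Q ≤ δ S`, `0 ≤ δ < 1`, `rank Q ≤ r`).
* §4 **`gaussianMoment_eq_of_saturated`** (SHARPNESS: for `Q = δ·S` the moment EQUALS `(√(1−δ))⁻¹ ^ n`, `n` the dimension — the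
  lemma's constant with `r = n` is attained).

NOT HERE (honest): anything of Bałaban's; NE7b NOT PRINTED ∕ NOT PROVED; spine PROVED 0∕9; rung (B)+1 on a FINITE torus — NOT infinite
volume, NOT the mass gap, NOT Clay.
HONEST DEPENDENCY: continuum YM on T⁴ ⇐ BetaPertH ∧ nine spine estimates (0/9 proved); BetaPertH ⇐ (D1) ∧ (D4) ∧ CAP+tail.
-/

set_option autoImplicit false

open Matrix Finset MeasureTheory Real
open Summit.QuantumFields.BalabanUV.T4Continuum.NE7b.QuadFormSimDiag
open Summit.QuantumFields.BalabanUV.T4Continuum.NE7b.GaussianDominatedMoment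

namespace Summit.QuantumFields.BalabanUV.T4Continuum.NE7b.GaussianDeterminant

variable {n : Type*} [Fintype n] [DecidableEq n]

/-! ## §1 The Gaussian determinant formula -/

/-- A congruence to the unit form fixes `|det A|`: `Aᵀ S A = 1 ⟹ |det A| = (√(det S))⁻¹`. [folklore] -/
theorem abs_det_eq_of_congr_one {S A : Matrix n n ℝ} (hS : S.PosDef) (hSA : Aᵀ * S * A = 1) :
    |A.det| = (√(S.det))⁻¹ := by
  have h := congrArg Matrix.det hSA
  rw [det_mul, det_mul, det_transpose, det_one] at h
  -- `h : det A * det S * det A = 1`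
  have hdS : 0 < S.det := hS.det_pos
  have hsq : |A.det| ^ 2 = (S.det)⁻¹ := by
    rw [sq_abs]
    exact eq_inv_of_mul_eq_one_left (by linear_combination h)
  have h1 : |A.det| = √((S.det)⁻¹) := by
    rw [← hsq, Real.sqrt_sq (abs_nonneg _)]
  rw [h1, Real.sqrt_inv]

/-- **THE GAUSSIAN DETERMINANT FORMULA**: for a positive-definite real form `S` on `ℝⁿ`,
`∫ e^{−xᵀSx} dx = (Πᵢ √π) · (√(det S))⁻¹`. [folklore] -/
theorem integral_exp_neg_qf_eq {S : Matrix n n ℝ} (hS : S.PosDef) :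
    ∫ x, exp (-(x ⬝ᵥ (S *ᵥ x))) = (∏ _i : n, √π) * (√(S.det))⁻¹ := by
  obtain ⟨A, d, hA, hSA1, -⟩ := exists_transpose_mul_self_eq_one_and_diagonal hS Matrix.PosSemidef.zero
  have hSA : ∀ x, (A *ᵥ x) ⬝ᵥ (S *ᵥ (A *ᵥ x)) = ∑ i, x i ^ 2 := fun x => by rw [qf_mulVec, hSA1, qf_one]
  have hdet : 0 < |A.det| := abs_pos.2 hA
  have h := integral_comp_mulVec A hA (fun x => exp (-(x ⬝ᵥ (S *ᵥ x))))
  simp only [hSA] at h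
  rw [integral_exp_neg_sum_sq] at h
  rw [← (eq_inv_mul_iff_mul_eq₀ hdet.ne').1 h, abs_det_eq_of_congr_one hS hSA1, mul_comm]

/-! ## §2 The sacrificed Gaussian in closed form -/

omit [Fintype n] [DecidableEq n] in
/-- `Q ≤ δ·S` with `δ < 1` makes `S − Q` positive definite (`S − Q = (1−δ)·S + (δS − Q)`). [folklore] -/
theorem posDef_sub_of_dominated {S Q : Matrix n n ℝ} {δ : ℝ} (hS : S.PosDef) (hdom : (δ • S - Q).PosSemidef) (hδ : δ < 1) :
    (S - Q).PosDef := by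
  have e : S - Q = (1 - δ) • S + (δ • S - Q) := by rw [sub_smul, one_smul]; abel
  rw [e]
  exact (hS.smul (by linarith : 0 < 1 - δ)).add_posSemidef hdom

/-- **THE SACRIFICED GAUSSIAN IN CLOSED FORM**: `∫ e^{xᵀQx}·e^{−xᵀSx} dx = (Πᵢ √π) · (√(det(S − Q)))⁻¹` when `Q ≤ δS`, `δ < 1`.
[folklore] -/
theorem integral_exp_qf_mul_exp_neg_eq {S Q : Matrix n n ℝ} {δ : ℝ} (hS : S.PosDef) (hdom : (δ • S - Q).PosSemidef)
    (hδ : δ < 1) :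
    ∫ x, exp (x ⬝ᵥ (Q *ᵥ x)) * exp (-(x ⬝ᵥ (S *ᵥ x))) = (∏ _i : n, √π) * (√((S - Q).det))⁻¹ := by
  have e : (fun x : n → ℝ => exp (x ⬝ᵥ (Q *ᵥ x)) * exp (-(x ⬝ᵥ (S *ᵥ x)))) =
      fun x => exp (-(x ⬝ᵥ ((S - Q) *ᵥ x))) := by
    funext x
    rw [← exp_add, qf_sub]
    congr 1
    ring
  rw [e, integral_exp_neg_qf_eq (posDef_sub_of_dominated hS hdom hδ)]

/-- **THE MOMENT IN CLOSED FORM**: the normalised Gaussian moment of `e^{xᵀQx}` IS `√(det S) ∕ √(det(S − Q))` — an algebraic function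
of the displayed data (so, for background-dependent data `S_y, Q_y`, as measurable ∕ continuous in `y` as the data). [folklore] -/
theorem gaussianMoment_eq {S Q : Matrix n n ℝ} {δ : ℝ} (hS : S.PosDef) (hdom : (δ • S - Q).PosSemidef) (hδ : δ < 1) :
    (∫ x, exp (x ⬝ᵥ (Q *ᵥ x)) * exp (-(x ⬝ᵥ (S *ᵥ x)))) / (∫ x, exp (-(x ⬝ᵥ (S *ᵥ x)))) =
      √(S.det) / √((S - Q).det) := by
  have hπ : (∏ _i : n, √π) ≠ 0 := Finset.prod_ne_zero_iff.2 fun _ _ => (Real.sqrt_pos.2 Real.pi_pos).ne'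
  have hS0 : √(S.det) ≠ 0 := (Real.sqrt_pos.2 hS.det_pos).ne'
  have hSQ0 : √((S - Q).det) ≠ 0 := (Real.sqrt_pos.2 (posDef_sub_of_dominated hS hdom hδ).det_pos).ne'
  rw [integral_exp_qf_mul_exp_neg_eq hS hdom hδ, integral_exp_neg_qf_eq hS]
  field_simp

/-! ## §3 The determinant reading of the domination lemma -/

/-- **THE DOMINATION LEMMA IN DETERMINANT CURRENCY**: for `S` positive definite, `Q` positive semidefinite, `Q ≤ δ·S`, `0 ≤ δ < 1`
and `rank Q ≤ r`: `(1 − δ)^r · det S ≤ det(S − Q)` (read off the integral inequality through the two closed forms). [folklore] -/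
theorem det_le_det_sub_of_dominated {S Q : Matrix n n ℝ} {δ : ℝ} {r : ℕ} (hS : S.PosDef) (hQ : Q.PosSemidef)
    (hdom : (δ • S - Q).PosSemidef) (hδ0 : 0 ≤ δ) (hδ : δ < 1) (hr : Q.rank ≤ r) :
    (1 - δ) ^ r * S.det ≤ (S - Q).det := by
  have hdS : 0 < S.det := hS.det_pos
  have hdSQ : 0 < (S - Q).det := (posDef_sub_of_dominated hS hdom hδ).det_pos
  have h1 : 0 < 1 - δ := by linarith
  -- the moment inequality in closed form: `√det S ≤ (√(1−δ))⁻¹ ^ r · √det(S−Q)`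
  have hm := gaussianMoment_le_of_dominated hS hQ hdom hδ0 hδ hr
  rw [gaussianMoment_eq hS hdom hδ, div_le_iff₀ (Real.sqrt_pos.2 hdSQ)] at hm
  have hs : 0 < √(1 - δ) := Real.sqrt_pos.2 h1
  have h2 : √(1 - δ) ^ r * √(S.det) ≤ √((S - Q).det) := by
    calc √(1 - δ) ^ r * √(S.det) ≤ √(1 - δ) ^ r * ((√(1 - δ))⁻¹ ^ r * √((S - Q).det)) :=
          mul_le_mul_of_nonneg_left hm (pow_nonneg hs.le r)
      _ = √((S - Q).det) := by rw [← mul_assoc, ← mul_pow, mul_inv_cancel₀ hs.ne', one_pow, one_mul]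
  -- square it
  have h3 := pow_le_pow_left₀ (mul_nonneg (pow_nonneg hs.le r) (Real.sqrt_nonneg _)) h2 2
  rw [mul_pow, ← pow_mul, mul_comm r 2, pow_mul, Real.sq_sqrt h1.le, Real.sq_sqrt hdS.le, Real.sq_sqrt hdSQ.le] at h3
  exact h3

/-! ## §4 Sharpness -/

/-- `√(a^k) = (√a)^k` for `0 ≤ a`. [folklore] -/
theorem sqrt_pow_eq {a : ℝ} (h : 0 ≤ a) (k : ℕ) : √(a ^ k) = (√a) ^ k := by
  rw [Real.sqrt_eq_iff_mul_self_eq (pow_nonneg h k) (pow_nonneg (Real.sqrt_nonneg a) k), ← mul_pow,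
    Real.mul_self_sqrt h]

/-- **SHARPNESS OF THE DOMINATION LEMMA**: when every direction is saturated, `Q = δ·S` (`0 ≤ δ < 1`), the normalised Gaussian moment
EQUALS `(√(1−δ))⁻¹ ^ n` with `n` the dimension — the lemma's constant for `r = rank Q = n` is attained. [folklore] -/
theorem gaussianMoment_eq_of_saturated {S : Matrix n n ℝ} {δ : ℝ} (hS : S.PosDef) (hδ : δ < 1) :
    (∫ x, exp (x ⬝ᵥ ((δ • S) *ᵥ x)) * exp (-(x ⬝ᵥ (S *ᵥ x)))) / (∫ x, exp (-(x ⬝ᵥ (S *ᵥ x)))) =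
      (√(1 - δ))⁻¹ ^ Fintype.card n := by
  have hdom : (δ • S - δ • S).PosSemidef := by rw [sub_self]; exact Matrix.PosSemidef.zero
  have h1 : 0 < 1 - δ := by linarith
  have hdS : 0 < S.det := hS.det_pos
  rw [gaussianMoment_eq hS hdom hδ, show S - δ • S = (1 - δ) • S by rw [sub_smul, one_smul], det_smul,
    Real.sqrt_mul' _ hdS.le, sqrt_pow_eq h1.le, inv_pow]
  have hS0 : √(S.det) ≠ 0 := (Real.sqrt_pos.2 hdS).ne'
  have hp0 : √(1 - δ) ^ Fintype.card n ≠ 0 := pow_ne_zero _ (Real.sqrt_pos.2 h1).ne'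
  field_simp

end Summit.QuantumFields.BalabanUV.T4Continuum.NE7b.GaussianDeterminant
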